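import Literature.AnabelianGeometry.EtaleTheta.Discharge.Sec2InertiaClauseEllFree
import HarnessLib

/-!
# [EtTh] §2 over §1: the Θ-level inertia clause IS the tree's per-`l` clause at `l = 0`

S. Mochizuki, *The étale theta function and its Frobenioid-theoretic manifestations*, Publ. RIMS **45**
(2009) [EtTh], §2, discussion preceding Def. 2.1, PRIMS p. 261 (PDF p. 35): «`Δ^Θ_X := Δ_X/[Δ_X,
[Δ_X, Δ_X]]` … we write `Δ_Θ` for the image of `∧² Δ^ell_X` in `Δ^Θ_X` … Now let `l ≥ 1` be an integer …
`Δ^Θ_X ↠ Δ̄_X` … Then there is a natural injective [outer] homomorphism `D_x → Π^Θ_X` … which maps the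
inertia group `I_x ⊆ D_x` isomorphically onto `Δ_Θ`. Thus, we have exact sequences … `1 → Δ̄_Θ → D̄_x →
G_K → 1`» [cite: MochizukiEtTh2009, Def 2.1 p.35].

Cell abc-iut, layer L2, seat abc-iut-w6-d077 (gen 2), ROW R203/R205 context. abc-iut-w6-d059's
`Sec2InertiaClauseEllFree` (p436885) proves, for a compact `H ≤ Π_X`, that the per-`l` clauses
`H ⊔ barKerHat l = barThetaHat l` for all `l > 0` are equivalent to ONE `l`-free clause
`H ⊔ [Δ_X,[Δ_X,Δ_X]]⁻ = [Δ_X,Δ_X]⁻` («`I_x ↠ Δ_Θ ⊆ Δ^Θ_X`»); abc-iut-L2-t10's `Sec2InertiaOfCommutatorAxis`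
(p434006) gives the commutator-axis direction. This PROOF-ONLY complement (0 definitions; nothing of those
files restated — consumed BY NAME) records the bookkeeping fact that makes a NEW field shape unnecessary:

* `ClassTwoBar.powSet_zero`, `barKerOf_zero`, `barThetaOf_zero`; `ThetaSetting.deltaHatPow_zero`,
  **`barKerHat_zero`** (`barKerHat 0 = [Δ_X,[Δ_X,Δ_X]]⁻ = Ker(Δ_X ↠ Δ^Θ_X)`), **`barThetaHat_zero`**
  (`barThetaHat 0 = [Δ_X,Δ_X]⁻`, the `Δ_Θ`-preimage) — the `0`-th powers generate nothing, so the tree's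
  `l`-indexed subgroups AT `l = 0` are exactly the Θ-level (Heisenberg-quotient) objects of p. 261;
* hence **`sup_barKerHat_zero_iff_forall_pos`** / `sup_barKerHat_zero_iff_forall`: for compact `H`,
  `H ⊔ barKerHat 0 = barThetaHat 0 ↔ (∀ l > 0, …) ↔ (∀ l, …)`; `iInf_pos_barKerHat_eq_zero` /
  `iInf_pos_barThetaHat_eq_zero`; `closure_zpowers_commutator_sup_barKerHat_all` (abc-iut-L2-t10's
  identity for EVERY `l : ℕ`);
* at the cusp and inside `Π_C`, for every profinite input bundle `I : D.PiCData PiC` (compact `D_x`,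
  once-punctured datum `e`): **`PiCData.inertia_sup_barKer_zero_iff_forall_pos`** — the binder `hIx` of
  `coverDataAx` AT `l = 0` is equivalent to the whole family `hIx`, `l > 0`; `PiCData.barKer_zero` /
  `barTheta_zero` identify the `l = 0` binder as «`(D_x ∩ Δ_C) · Ker(Δ_X ↠ Δ^Θ_X) = Δ_Θ`-preimage».

So the v-next «inertia generates `Δ_Θ`» clause can be STATED IN THE EXISTING VOCABULARY as the `l = 0`
member of the binder family (census note; no side taken on which shape the interface owners adopt).
HONEST LIMITS: nothing of [EtTh] is asserted; the clauses are hypotheses satisfied by no model in the tree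
(`SettingModelCuspAxis`, p433801); no new `Prop` fact; no side is taken on [IUTchIII] Cor. 3.12; typed ≠ proved.
-/

noncomputable section

namespace Literature.AnabelianGeometry.EtaleTheta

open scoped commutatorElement
open _root_.Topology Literature.AnabelianGeometry.SemiGraphs

/-! ## §1. Generic: the recipe at `l = 0` -/

namespace ClassTwoBar

variable {G : Type*} [Group G] (Δ : Subgroup G)

/-- The `0`-th powers of a subgroup: `{y^0} = {1}`. [cite: MochizukiEtTh2009, Def 2.1 p.35] -/
theorem powSet_zero : powSet Δ 0 = {1} := by
  ext x
  simp only [powSet, pow_zero, Set.mem_setOf_eq, Set.mem_singleton_iff]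
  exact ⟨fun ⟨_, _, hx⟩ => hx, fun hx => ⟨1, Δ.one_mem, hx⟩⟩

/-- `⟨0-th powers⟩^normal = ⊥`. [cite: MochizukiEtTh2009, Def 2.1 p.35] -/
theorem normalClosure_powSet_zero : Subgroup.normalClosure (powSet Δ 0) = ⊥ := by
  rw [powSet_zero]
  refine le_antisymm (Subgroup.normalClosure_le_normal ?_) bot_le
  intro x hx
  rw [Set.mem_singleton_iff] at hx
  simp [hx]

variable [TopologicalSpace G] [IsTopologicalGroup G]

/-- **`barKerOf Δ 0 = [Δ,[Δ,Δ]]⁻`**: at `l = 0` the recipe `Ker(Δ ↠ Δ̄)` returns the kernel to the theta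
quotient `Δ^Θ = Δ/[Δ,[Δ,Δ]]` (p. 261). [cite: MochizukiEtTh2009, Def 2.1 p.35] -/
theorem barKerOf_zero : barKerOf Δ 0 = (⁅⁅Δ, Δ⁆, Δ⁆).topologicalClosure := by
  change (⁅⁅Δ, Δ⁆, Δ⁆ ⊔ Subgroup.normalClosure (powSet Δ 0)).topologicalClosure = _
  rw [normalClosure_powSet_zero, sup_bot_eq]

/-- **`barThetaOf Δ 0 = [Δ,Δ]⁻`**: at `l = 0` the `Δ̄_Θ`-preimage recipe returns the `Δ_Θ`-preimage
(p. 261, `Δ_Θ = Im(∧² Δ^ell)`). [cite: MochizukiEtTh2009, Def 2.1 p.35] -/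
theorem barThetaOf_zero : barThetaOf Δ 0 = (⁅Δ, Δ⁆).topologicalClosure := by
  change (⁅Δ, Δ⁆ ⊔ Subgroup.normalClosure (powSet Δ 0)).topologicalClosure = _
  rw [normalClosure_powSet_zero, sup_bot_eq]

end ClassTwoBar

namespace ThetaSetting

variable {p : ℕ} [Fact p.Prime] (D : ThetaSetting p)

/-! ## §2. `Π_X`: `barKerHat 0`, `barThetaHat 0` and the Θ-level clause -/

/-- The `0`-th powers of `Δ_X` generate nothing: `deltaHatPow 0 = ⊥`. [cite: MochizukiEtTh2009, Def 2.1 p.35] -/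
theorem deltaHatPow_zero : D.deltaHatPow 0 = ⊥ := by
  refine le_antisymm (Subgroup.normalClosure_le_normal ?_) bot_le
  rintro x ⟨y, -, rfl⟩
  simp

/-- **`barKerHat 0 = [Δ_X,[Δ_X,Δ_X]]⁻ = Ker(Δ_X ↠ Δ^Θ_X)`** («`Δ^Θ_X := Δ_X/[Δ_X, [Δ_X, Δ_X]]`», p. 261).
[cite: MochizukiEtTh2009, Def 2.1 p.35] -/
theorem barKerHat_zero :
    D.barKerHat 0 = (⁅⁅D.DeltaHat, D.DeltaHat⁆, D.DeltaHat⁆).topologicalClosure := by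
  change (⁅⁅D.DeltaHat, D.DeltaHat⁆, D.DeltaHat⁆ ⊔ D.deltaHatPow 0).topologicalClosure = _
  rw [D.deltaHatPow_zero, sup_bot_eq]

/-- **`barThetaHat 0 = [Δ_X,Δ_X]⁻`**, the `Δ_Θ`-preimage in `Δ_X` (p. 261). [cite: MochizukiEtTh2009, Def 2.1 p.35] -/
theorem barThetaHat_zero : D.barThetaHat 0 = (⁅D.DeltaHat, D.DeltaHat⁆).topologicalClosure := by
  change (⁅D.DeltaHat, D.DeltaHat⁆ ⊔ D.deltaHatPow 0).topologicalClosure = _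
  rw [D.deltaHatPow_zero, sup_bot_eq]

/-- `⨅_{l>0} barKerHat l = barKerHat 0` (abc-iut-w6-d059's `iInf_barKerHat_eq_closure`, re-indexed).
[cite: MochizukiEtTh2009, Def 2.1 p.35] -/
theorem iInf_pos_barKerHat_eq_zero : ⨅ (l : ℕ) (_ : 0 < l), D.barKerHat l = D.barKerHat 0 := by
  rw [D.iInf_barKerHat_eq_closure, D.barKerHat_zero]

/-- `⨅_{l>0} barThetaHat l = barThetaHat 0` (abc-iut-w6-d059's `iInf_barThetaHat_eq_closure`, re-indexed).
[cite: MochizukiEtTh2009, Def 2.1 p.35] -/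
theorem iInf_pos_barThetaHat_eq_zero : ⨅ (l : ℕ) (_ : 0 < l), D.barThetaHat l = D.barThetaHat 0 := by
  rw [D.iInf_barThetaHat_eq_closure, D.barThetaHat_zero]

/-- `barKerHat` and `barThetaHat` are ANTITONE in divisibility through `0`: `barKerHat 0 ≤ barKerHat l`.
[cite: MochizukiEtTh2009, Def 2.1 p.35] -/
theorem barKerHat_zero_le (l : ℕ) : D.barKerHat 0 ≤ D.barKerHat l := by
  rw [D.barKerHat_zero]; exact D.tripleCommutatorClosure_le_barKerHat l

/-- `barThetaHat 0 ≤ barThetaHat l`. [cite: MochizukiEtTh2009, Def 2.1 p.35] -/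
theorem barThetaHat_zero_le (l : ℕ) : D.barThetaHat 0 ≤ D.barThetaHat l := by
  rw [D.barThetaHat_zero]; exact D.commutatorClosure_le_barThetaHat l

/-- **The Θ-level clause is the per-`l` clause at `l = 0`, and is equivalent to all `l > 0`**: for a
compact `H ≤ Π_X`, `H ⊔ barKerHat 0 = barThetaHat 0 ↔ ∀ l > 0, H ⊔ barKerHat l = barThetaHat l`
(abc-iut-w6-d059's `forall_sup_barKerHat_eq_iff`, read through `barKerHat_zero` / `barThetaHat_zero`).
[cite: MochizukiEtTh2009, Def 2.1 p.35] -/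
theorem sup_barKerHat_zero_iff_forall_pos (H : Subgroup D.PiHat) (hH : IsCompact (H : Set D.PiHat)) :
    H ⊔ D.barKerHat 0 = D.barThetaHat 0 ↔ ∀ l : ℕ, 0 < l → H ⊔ D.barKerHat l = D.barThetaHat l := by
  rw [D.barKerHat_zero, D.barThetaHat_zero]
  exact (D.forall_sup_barKerHat_eq_iff H hH).symm

/-- The same with ALL `l : ℕ` on the right (the `l = 0` member implies every member).
[cite: MochizukiEtTh2009, Def 2.1 p.35] -/
theorem sup_barKerHat_zero_iff_forall (H : Subgroup D.PiHat) (hH : IsCompact (H : Set D.PiHat)) :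
    H ⊔ D.barKerHat 0 = D.barThetaHat 0 ↔ ∀ l : ℕ, H ⊔ D.barKerHat l = D.barThetaHat l := by
  refine ⟨fun h0 l => ?_, fun h => h 0⟩
  have hE : H ⊔ (⁅⁅D.DeltaHat, D.DeltaHat⁆, D.DeltaHat⁆).topologicalClosure =
      (⁅D.DeltaHat, D.DeltaHat⁆).topologicalClosure := by
    rw [← D.barKerHat_zero, ← D.barThetaHat_zero]; exact h0
  exact D.sup_barKerHat_eq_of_sup_closure_eq H hH hE l

/-- abc-iut-L2-t10's `closure_zpowers_commutator_sup_barKerHat` **for every `l : ℕ`** (at `l = 0` it is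
abc-iut-w6-d059's `closure_zpowers_commutator_sup_closure_eq`): `⟨[a,b]⟩⁻ ⊔ barKerHat l = barThetaHat l`
for any topological generating pair `a, b` of `Δ_X`. [cite: MochizukiEtTh2009, Def 2.1 p.35] -/
theorem closure_zpowers_commutator_sup_barKerHat_all (l : ℕ) {a b : D.DeltaHat}
    (hdense : (Subgroup.closure ({a, b} : Set D.DeltaHat)).topologicalClosure = ⊤) :
    (Subgroup.zpowers (⁅(a : D.PiHat), (b : D.PiHat)⁆)).topologicalClosure ⊔ D.barKerHat l =
      D.barThetaHat l := by
  haveI : CompactSpace D.PiHat := D.isProfiniteCompletion_toHat.compactSpace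
  have h0 : (Subgroup.zpowers (⁅(a : D.PiHat), (b : D.PiHat)⁆)).topologicalClosure ⊔ D.barKerHat 0 =
      D.barThetaHat 0 := by
    rw [D.barKerHat_zero, D.barThetaHat_zero]
    exact D.closure_zpowers_commutator_sup_closure_eq hdense
  exact (D.sup_barKerHat_zero_iff_forall _ (Subgroup.isClosed_topologicalClosure _).isCompact).1 h0 l

/-- **At the cusp** (compact `D_x`): the inertia clause at `l = 0`, `toHat(I_x) ⊔ barKerHat 0 = barThetaHat 0`
(«`I_x ↠ Δ_Θ` in `Π^Θ_X`»), is equivalent to the clauses at all `l > 0` («`1 → Δ̄_Θ → D̄_x → G_K → 1`»).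
[cite: MochizukiEtTh2009, Def 2.1 p.35] -/
theorem inertiaClause_zero_iff_forall_pos (x : D.Pt) (hcpt : IsCompact (D.decomp x : Set D.PiTemp)) :
    (D.inertia x).map D.toHat.toMonoidHom ⊔ D.barKerHat 0 = D.barThetaHat 0 ↔
      ∀ l : ℕ, 0 < l → (D.inertia x).map D.toHat.toMonoidHom ⊔ D.barKerHat l = D.barThetaHat l :=
  D.sup_barKerHat_zero_iff_forall_pos _ (D.isCompact_map_inertia x hcpt)

/-- At the cusp, commutator-axis form ⇒ the `l = 0` clause (abc-iut-L2-t10's bridge at `l = 0`).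
[cite: MochizukiEtTh2009, Def 2.1 p.35] -/
theorem inertiaClause_zero_of_commutatorAxis (x : D.Pt) {a b : D.DeltaHat}
    (hdense : (Subgroup.closure ({a, b} : Set D.DeltaHat)).topologicalClosure = ⊤)
    (hI : (D.inertia x).map D.toHat.toMonoidHom =
      (Subgroup.zpowers (⁅(a : D.PiHat), (b : D.PiHat)⁆)).topologicalClosure) :
    (D.inertia x).map D.toHat.toMonoidHom ⊔ D.barKerHat 0 = D.barThetaHat 0 := by
  rw [hI]
  exact D.closure_zpowers_commutator_sup_barKerHat_all 0 hdense

/-! ## §3. Inside `Π_C`: the binder `hIx` at `l = 0` versus the family `hIx`, `l > 0` -/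

namespace PiCData

variable {D} {PiC : Type} [Group PiC] [TopologicalSpace PiC] [IsTopologicalGroup PiC] [T2Space PiC]
  (I : D.PiCData PiC)

/-- `I.barKer 0 = [Δ_X,[Δ_X,Δ_X]]⁻` inside `Π_C` (`Δ_X = I.DeltaX`): the `l = 0` binder subgroup is the
kernel to the theta quotient. [cite: MochizukiEtTh2009, Def 2.1 p.35] -/
theorem barKer_zero : I.barKer 0 = (⁅⁅I.DeltaX, I.DeltaX⁆, I.DeltaX⁆).topologicalClosure :=
  ClassTwoBar.barKerOf_zero I.DeltaX

/-- `I.barTheta 0 = [Δ_X,Δ_X]⁻` inside `Π_C`: the `l = 0` binder subgroup is the `Δ_Θ`-preimage.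
[cite: MochizukiEtTh2009, Def 2.1 p.35] -/
theorem barTheta_zero : I.barTheta 0 = (⁅I.DeltaX, I.DeltaX⁆).topologicalClosure :=
  ClassTwoBar.barThetaOf_zero I.DeltaX

/-- **The binder `hIx` AT `l = 0` ⟺ the binder family `hIx`, `l > 0`** (compact `D_x`, once-punctured
datum `e`): «`(D_x ∩ Δ_C) · Ker(Δ_X ↠ Δ^Θ_X)` is the `Δ_Θ`-preimage» ⟺ «`(D_x ∩ Δ_C) · Ker(Δ_X ↠ Δ̄_X)` is
the `Δ̄_Θ`-preimage for every `l > 0`» — the v-next «inertia generates `Δ_Θ`» clause is expressible as the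
`l = 0` member of the existing binder family. [cite: MochizukiEtTh2009, Def 2.1 p.35] -/
theorem inertia_sup_barKer_zero_iff_forall_pos (e : D.OncePuncturedData) (x : D.Pt)
    (hcpt : IsCompact (D.decomp x : Set D.PiTemp)) :
    (I.Dx x ⊓ I.augGK.ker) ⊔ I.barKer 0 = I.barTheta 0 ↔
      ∀ l : ℕ, 0 < l → (I.Dx x ⊓ I.augGK.ker) ⊔ I.barKer l = I.barTheta l := by
  rw [I.inertia_sup_barKer_iff_inertia 0 e x hcpt, D.inertiaClause_zero_iff_forall_pos x hcpt]
  refine forall_congr' fun l => forall_congr' fun _ => ?_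
  exact (I.inertia_sup_barKer_iff_inertia l e x hcpt).symm

/-- The direction consumers use: the `l = 0` binder gives `hIx` at every `l > 0`.
[cite: MochizukiEtTh2009, Def 2.1 p.35] -/
theorem inertia_sup_barKer_of_zero (l : ℕ) (hl : 0 < l) (e : D.OncePuncturedData) (x : D.Pt)
    (hcpt : IsCompact (D.decomp x : Set D.PiTemp))
    (h0 : (I.Dx x ⊓ I.augGK.ker) ⊔ I.barKer 0 = I.barTheta 0) :
    (I.Dx x ⊓ I.augGK.ker) ⊔ I.barKer l = I.barTheta l :=
  (I.inertia_sup_barKer_zero_iff_forall_pos e x hcpt).1 h0 l hl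

end PiCData

end ThetaSetting

end Literature.AnabelianGeometry.EtaleTheta

end
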